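import Literature.Probability.RandomPlanarGeometry.SAWCountZdFifthCoefficient
import Literature.Probability.RandomPlanarGeometry.SAWCountZdCoefficientPolynomiality
import HarnessLib

/-!
# The fifth `1/d`-coefficient of the counting polynomial `countPoly n` of `c_n(ℤ^d)`, explicitly, for every `n ≥ 7`

Topic `Literature/Probability/RandomPlanarGeometry` (corollary module: `SAWCountZdCoefficientPolynomiality.lean` (a-p1 g22: `countPoly n ∈ ℚ[X]`, the
polynomial with `c_n(ℤ^d) = (countPoly n)(d)` for all `d ≥ 1` — `count_eq_eval_countPoly`; EXISTENCE of the coefficient polynomials `S_j`) and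
`SAWCountZdFifthCoefficient.lean` (a-p1 g23: (L1′) unconditional — `exists_polynomial_count_fifth`, an interpolating polynomial with the five top
coefficients explicit)).

PRINTED CONTEXT (locators only; nothing is quoted digit-for-digit). Madras–Slade (1993) §1.1 eq. (1.1.8) p. 5 (the `1/d` expansion of `μ`), §1.2 p. 10;
Clisby–Liang–Slade (2007) §1.3 eq. (1). The coefficient statements below, as laws in `n`, are the lane's (not located in print by the desks).

THIS FILE: ★ `countPoly_eq_of_forall_count` (the counting polynomial is determined by the counts: any `P ∈ ℚ[X]` with `c_n(ℤ^d) = P(d)` for all `d`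
equals `countPoly n`, `n ≥ 1`), and ★★★ `countPoly_coeff_top_five`: for every `n ≥ 7`,
`[X^n] countPoly n = 2^n`, `[X^{n−1}] = −(n−1)·2^{n−1}`, `[X^{n−2}] = 2^{n−3}(n² − 5n + 8)`, `48·[X^{n−3}] = −2^n(n³ − 12n² + 59n − 138)`,
`24·[X^{n−4}] = 2^{n−4}(n⁴ − 22n³ + 215n² − 1298n + 4272)` — the explicit `S₂, S₃, S₄` of the existence theorem `exists_polynomial_countPoly_coeff`
(with `natDegree (countPoly n) ≤ n`, `natDegree_countPoly_le`). [cite: MadrasSlade1993, §1.1 eq. (1.1.8) p. 5; §1.2 p. 10] [cite: ClisbyLiangSlade2007, §1.3 eq. (1)]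

Provenance: lane «pcv-sawmu», a-p1 g23 (2026-08-27).
-/

open Finset
open scoped BigOperators
open Literature.Probability.LatticeModels
open Literature.Probability.RandomPlanarGeometry.SAW
open Literature.Probability.Percolation

namespace Literature.Probability.RandomPlanarGeometry.SAW.Zd

namespace WordTypes

/-- ★ THE COUNTING POLYNOMIAL IS DETERMINED BY THE COUNTS: a rational polynomial taking the value `c_n(ℤ^d)` at every `d` is `countPoly n` (`n ≥ 1`).
[cite: MadrasSlade1993, §1.1 eq. (1.1.8) p. 5; lane lemma] -/
theorem countPoly_eq_of_forall_count {n : ℕ} (hn : 1 ≤ n) (P : Polynomial ℚ) (hP : ∀ d : ℕ, (count d n : ℚ) = P.eval (d : ℚ)) :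
    countPoly n = P := by
  apply Polynomial.eq_of_infinite_eval_eq (countPoly n) P
  have hsub : (Set.range fun d : ℕ => ((d + 1 : ℕ) : ℚ)) ⊆ {x | (countPoly n).eval x = P.eval x} := by
    rintro x ⟨d, rfl⟩
    show (countPoly n).eval ((d + 1 : ℕ) : ℚ) = P.eval ((d + 1 : ℕ) : ℚ)
    rw [← count_eq_eval_countPoly hn d, hP (d + 1)]
  refine Set.Infinite.mono hsub (Set.infinite_range_of_injective fun a b h => ?_)
  have : ((a + 1 : ℕ) : ℚ) = ((b + 1 : ℕ) : ℚ) := h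
  have : a + 1 = b + 1 := by exact_mod_cast this
  omega

/-- ★ The counting polynomial of the `n`-step self-avoiding walks has degree at most `n` (`n ≥ 7`; from the interpolating polynomial of (L1′)).
[cite: MadrasSlade1993, §1.1 eq. (1.1.8) p. 5; lane lemma] -/
theorem natDegree_countPoly_le {n : ℕ} (hn : 7 ≤ n) : (countPoly n).natDegree ≤ n := by
  obtain ⟨P, hdeg, -, -, -, -, -, hev⟩ := exists_polynomial_count_fifth n hn
  rw [countPoly_eq_of_forall_count (by omega) P hev]
  exact hdeg

/-- ★★★ THE FIVE TOP COEFFICIENTS OF `countPoly n` (`n ≥ 7`): `[X^n] = 2^n`, `[X^{n−1}] = −(n−1)·2^{n−1}`, `[X^{n−2}] = 2^{n−3}(n² − 5n + 8)`,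
`48·[X^{n−3}] = −2^n(n³ − 12n² + 59n − 138)` and the FIFTH `24·[X^{n−4}] = 2^{n−4}(n⁴ − 22n³ + 215n² − 1298n + 4272)` — (L1′) read on the canonical object.
[cite: MadrasSlade1993, §1.1 eq. (1.1.8) p. 5; §1.2 p. 10] [cite: ClisbyLiangSlade2007, §1.3 eq. (1); lane theorem] -/
theorem countPoly_coeff_top_five {n : ℕ} (hn : 7 ≤ n) :
    (countPoly n).coeff n = (2 : ℚ) ^ n ∧
      (countPoly n).coeff (n - 1) = -((n : ℚ) - 1) * 2 ^ (n - 1) ∧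
      (countPoly n).coeff (n - 2) = 2 ^ (n - 3) * ((n : ℚ) ^ 2 - 5 * (n : ℚ) + 8) ∧
      48 * (countPoly n).coeff (n - 3) = -(2 : ℚ) ^ n * ((n : ℚ) ^ 3 - 12 * (n : ℚ) ^ 2 + 59 * (n : ℚ) - 138) ∧
      24 * (countPoly n).coeff (n - 4) = (2 : ℚ) ^ (n - 4) * ((n : ℚ) ^ 4 - 22 * (n : ℚ) ^ 3 + 215 * (n : ℚ) ^ 2 - 1298 * (n : ℚ) + 4272) := by
  obtain ⟨P, -, h0, h1, h2, h3, h4, hev⟩ := exists_polynomial_count_fifth n hn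
  rw [countPoly_eq_of_forall_count (by omega) P hev]
  exact ⟨h0, h1, h2, h3, h4⟩

/-- ★★ THE FIFTH `1/d`-SYMBOL AS A COEFFICIENT OF `countPoly`: `[X^{n−4}] countPoly n = 2^{n−4}(n⁴ − 22n³ + 215n² − 1298n + 4272)/24` for every `n ≥ 7` —
the explicit `S₄(n) = (n⁴ − 22n³ + 215n² − 1298n + 4272)/384` of `exists_polynomial_countPoly_coeff 4`. [cite: MadrasSlade1993, §1.1 eq. (1.1.8) p. 5; lane theorem] -/
theorem countPoly_coeff_sub_four {n : ℕ} (hn : 7 ≤ n) :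
    (countPoly n).coeff (n - 4) = (2 : ℚ) ^ (n - 4) * ((n : ℚ) ^ 4 - 22 * (n : ℚ) ^ 3 + 215 * (n : ℚ) ^ 2 - 1298 * (n : ℚ) + 4272) / 24 := by
  have h := (countPoly_coeff_top_five hn).2.2.2.2
  rw [← h]; ring

end WordTypes

end Literature.Probability.RandomPlanarGeometry.SAW.Zd
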